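import Summits.ResolutionOfSingularities.ResolutionOfSingularities.Theorems.FrobeniusLadderFInjectiveMacaulayficationFTemkinClosedPointsFibre
import Summits.ResolutionOfSingularities.ResolutionOfSingularities.Theorems.FrobeniusLadderFInjectiveMacaulayficationLocalFullificationFibreAdmGe4
import Summits.ResolutionOfSingularities.ResolutionOfSingularities.Theorems.FrobeniusLadderFInjectiveMacaulayficationLocalMacaulayficationOfFact
import Summits.ResolutionOfSingularities.ResolutionOfSingularities.Theorems.FrobeniusLadderFInjectiveMacaulayficationRegularBlowupModelDim2
import Summits.ResolutionOfSingularities.ResolutionOfSingularities.Theorems.FrobeniusLadderFInjectiveMacaulayficationRelClosedSubsetFixFinite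
import HarnessLib

/-!
# THE CM / F SPLIT OF (LF_adm) `LocalFullificationFibreAdmGe4` (door v36.2 «AD»): (LF_adm) ⟺ (LF_adm-CM) ∧ (LF_adm-F), and the CM-half from Česnavičius
# (crux `FInjectiveMacaulayfication` stmt-ResolutionOfSingularities-15315, chain w45a; res-L1-w45a-plan-1 RULING R17.8 (AD1); the `Adm` twin of this seat's
# p589132 `LocalFullificationFibreClosedGe4Split` by the same two insertions — `x ∉ Scheme.regularLocus X →` and the admissibility of `I`; seat
# res-L1-w45a-stub-2 g6)

[OURS · L1 W4.5a] Support file (`--supports stmt-ResolutionOfSingularities-15315 --as helper`); TWO `Prop`-valued CANDIDATE statements of OURS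
(`@[conjecture] def`, consumed only as hypotheses; no instance, no notation, no named fact), the PROVED equivalence with (LF_adm), and the CM-half
discharged modulo ONE printed result taken as a binder (`hM` = the candidate Literature text `CesnaviciusBlowupMacaulayfication`, Česnavičius 2021
Thm. 5.3 blow-up form, FACT-REQUEST of record); replaces the role of NO printed item; NOT a statement of the manuscript; AI-written (AI review is weaker
than expert review).

* (LF_adm-CM) `LocalMacaulayficationFibreAdmGe4` — (LF_adm) with conclusion «domain ∧ CM-clause at every point»;
* (LF_adm-F) **`LocalFInjectivizationFibreAdmGe4`** — (LF_adm) with the EXTRA hypothesis `∀ s, CMCl 𝒪_{S′,s}`: «a Cohen–Macaulay integral local scheme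
  that is a Sing-ADMISSIBLE blowing up of `Spec 𝒪_{X,x}` at a SINGULAR CLOSED point `x` of local dimension `d ≥ 4`, regular off its closed fibre, is
  FULL-ified by one fibre-supported blowing up» — THE OPEN F-HALF in Temkin's admissible category (the instance programme's target under v36.2/v37);
* `localFullificationFibreAdmGe4_iff_split` — PROVED as in p589132 (`d`, closedness, singularity of `x` and admissibility of `I` carried along; the
  intermediate model `S₁ = Bl_{𝓚₁} S′ → Spec 𝒪_{X,x}` is again ADMISSIBLE: its 080B centre has support in `supp I ∪ g(supp 𝓚₁) ⊆ Sing ∪ {closed point}`,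
  and the closed point of `Spec 𝒪_{X,x}` is singular because `x ∉ Reg X` — `closedPoint_not_mem_regularLocus`);
* `localMacaulayficationFibreAdmGe4_of_fact (hM)` — (LF_adm-CM) ⟸ [Česnavičius 2021 Thm. 5.3] via this seat's `LocalMacaulayficationOfFact.exists_cmCentre_of_fact`;
* **`localFullificationFibreAdmGe4_of_fact_of_F (hM) (hF : LocalFInjectivizationFibreAdmGe4) : LocalFullificationFibreAdmGe4`** — door v37's shape in the
  admissible category.
≤ S bookkeeping: (LF_adm-F) ≤ (LF_adm) ≤ (LF_cl) ≤ S_loc (`LocalDoorYardstick`).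
[candidate statements, OURS; cite: Cesnavicius2021, Thm. 5.3 (CM-half); Temkin2008, Prop. 2.3.4 (iii) and §2.1; StacksProject, Tag 080B; Tag 085U]
-/

-- single-problem summit: the doubled namespace component is forced
set_option linter.dupNamespace false

noncomputable section

open AlgebraicGeometry CategoryTheory CategoryTheory.Limits Literature.AlgebraicGeometry.Resolution TopologicalSpace IsLocalRing

namespace Summit.ResolutionOfSingularities.ResolutionOfSingularities.Theorems.FInjectiveMacaulayfication.LocalFullificationFibreAdmGe4Split

open Summit.ResolutionOfSingularities.ResolutionOfSingularities.Theorems.FInjectiveMacaulayfication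
open SliceableCentre

/-! ## §1 The two halves -/

/-- [OURS · CANDIDATE statement, not a fact] **(LF_adm-CM) LOCAL MACAULAYFICATION OF ADMISSIBLE BLOW-UPS AT SINGULAR CLOSED POINTS OF LOCAL DIMENSION `d ≥ 4`,
FIBRE-SUPPORTED CENTRE.** Same data as (LF_adm) `LocalFullificationFibreAdmGe4` (binders verbatim): `d ≥ 4`, `X/k` integral separated of finite type
(`char k = p`), SINGULAR CLOSED `x ∈ X` with `dim 𝒪_{X,x} = d`, `I` supported in `Sing(Spec 𝒪_{X,x})`,
`g : S′ → Spec 𝒪_{X,x}` a blowing up along `I ≠ ⊥`, `S′` regular off the closed fibre. Conclusion: an ideal sheaf `𝓚 ≠ ⊥` on `S′` supported in the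
closed fibre such that EVERY blowing up `S″ → S′` along `𝓚` has, at EVERY point, a stalk that is a DOMAIN satisfying the CM-clause
(`SliceableCentre.CMCl`: every system of parameters weakly regular). An instance of Česnavičius's Macaulayfication in blow-up form (centre disjoint
from the CM locus, which contains the complement of the closed fibre) — known in print, candidate-tagged here until a named fact is filed.
[candidate statement, OURS; cite: Cesnavicius2021, Thm. 1.6 and Thm. 5.3 (context)] -/
@[conjecture] def LocalMacaulayficationFibreAdmGe4 : Prop :=
  ∀ d : ℕ, 4 ≤ d →
  ∀ (p : ℕ), p.Prime → ∀ (k : Type) [Field k] [CharP k p]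
    (X : Scheme.{0}) (f : X ⟶ Spec (.of k)),
      IsSeparated f → LocallyOfFiniteType f → QuasiCompact f → IsIntegral X →
      ∀ x : X, IsClosed ({x} : Set X) → x ∉ Scheme.regularLocus X → ringKrullDim (X.presheaf.stalk x) = d →
      ∀ (S' : Scheme.{0}) (g : S' ⟶ Spec (X.presheaf.stalk x)) (I : (Spec (X.presheaf.stalk x)).IdealSheafData),
        I ≠ ⊥ → (I.support : Set (Spec (X.presheaf.stalk x))) ⊆ (Scheme.regularLocus (Spec (X.presheaf.stalk x)))ᶜ → IsBlowup g I →
        (∀ s : S', g.base s ≠ closedPoint (X.presheaf.stalk x) → s ∈ Scheme.regularLocus S') →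
        ∃ 𝓚 : S'.IdealSheafData, 𝓚 ≠ ⊥ ∧ (∀ s ∈ (𝓚.support : Set S'), g.base s = closedPoint (X.presheaf.stalk x)) ∧
          ∀ (S'' : Scheme.{0}) (π : S'' ⟶ S'), IsBlowup π 𝓚 →
            ∀ s : S'', IsDomain (S''.presheaf.stalk s) ∧ CMCl (S''.presheaf.stalk s)

/-- [OURS · CANDIDATE statement, not a fact] **(LF_adm-F) LOCAL F-INJECTIVISATION OF A COHEN–MACAULAY ADMISSIBLE LOCAL BLOW-UP SCHEME OVER A SINGULAR CLOSED
POINT OF LOCAL DIMENSION `d ≥ 4`, FIBRE-SUPPORTED CENTRE.** (LF_adm) `LocalFullificationFibreAdmGe4` with ONE extra hypothesis: `S′` satisfies the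
CM-clause at every point. I.e. for `d ≥ 4`, `X/k`, SINGULAR CLOSED `x` (`dim 𝒪_{X,x} = d`), `I` supported in `Sing(Spec 𝒪_{X,x})`, `g : S′ → Spec 𝒪_{X,x}` a blowing up along `I ≠ ⊥`, `S′` regular off the closed fibre AND Cohen–Macaulay everywhere:
there is `𝓚 ≠ ⊥` supported in the closed fibre such that every blowing up of `S′` along `𝓚` is FULL (`SliceableCentre.FullCl`: domain ∧ CM-clause ∧
Frobenius-closed parameter ideals) at every point. THE OPEN HALF of the registered residue (LF_adm) of door v36.2. [candidate statement, OURS; open] -/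
@[conjecture] def LocalFInjectivizationFibreAdmGe4 : Prop :=
  ∀ d : ℕ, 4 ≤ d →
  ∀ (p : ℕ), p.Prime → ∀ (k : Type) [Field k] [CharP k p]
    (X : Scheme.{0}) (f : X ⟶ Spec (.of k)),
      IsSeparated f → LocallyOfFiniteType f → QuasiCompact f → IsIntegral X →
      ∀ x : X, IsClosed ({x} : Set X) → x ∉ Scheme.regularLocus X → ringKrullDim (X.presheaf.stalk x) = d →
      ∀ (S' : Scheme.{0}) (g : S' ⟶ Spec (X.presheaf.stalk x)) (I : (Spec (X.presheaf.stalk x)).IdealSheafData),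
        I ≠ ⊥ → (I.support : Set (Spec (X.presheaf.stalk x))) ⊆ (Scheme.regularLocus (Spec (X.presheaf.stalk x)))ᶜ → IsBlowup g I →
        (∀ s : S', g.base s ≠ closedPoint (X.presheaf.stalk x) → s ∈ Scheme.regularLocus S') →
        (∀ s : S', CMCl (S'.presheaf.stalk s)) →
        ∃ 𝓚 : S'.IdealSheafData, 𝓚 ≠ ⊥ ∧ (∀ s ∈ (𝓚.support : Set S'), g.base s = closedPoint (X.presheaf.stalk x)) ∧
          ∀ (S'' : Scheme.{0}) (π : S'' ⟶ S'), IsBlowup π 𝓚 →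
            ∀ s : S'', FullCl p (S''.presheaf.stalk s)

/-! ## §2 (LF_adm) ⇒ each half -/

/-- (LF_adm) ⇒ (LF_adm-CM): FULL stalks are domains satisfying the CM-clause. [folklore] -/
theorem localMacaulayficationFibreAdmGe4_of_localFullificationFibreAdmGe4
    (h : LocalFullificationFibreAdmGe4.LocalFullificationFibreAdmGe4) : LocalMacaulayficationFibreAdmGe4 := by
  intro d hd p hp k _ _ X f hsep hft hqc hint x hxcl hxs hx S' g I hI hIadm hg hreg
  obtain ⟨𝓚, h1, h2, h3⟩ := h d hd p hp k X f hsep hft hqc hint x hxcl hxs hx S' g I hI hIadm hg hreg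
  exact ⟨𝓚, h1, h2, fun S'' π hπ s => ⟨(h3 S'' π hπ s).1, RelClosedSubsetFixFinite.cmCl_of_fullCl (h3 S'' π hπ s)⟩⟩

/-- (LF_adm) ⇒ (LF_adm-F): drop the Cohen–Macaulay hypothesis. [folklore] -/
theorem localFInjectivizationFibreAdmGe4_of_localFullificationFibreAdmGe4
    (h : LocalFullificationFibreAdmGe4.LocalFullificationFibreAdmGe4) : LocalFInjectivizationFibreAdmGe4 := by
  intro d hd p hp k _ _ X f hsep hft hqc hint x hxcl hxs hx S' g I hI hIadm hg hreg _
  exact h d hd p hp k X f hsep hft hqc hint x hxcl hxs hx S' g I hI hIadm hg hreg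

/-! ## §3 The two halves ⇒ (LF_adm): Macaulayfy, then F-injectivise, and compose the two blowings up -/

set_option maxHeartbeats 800000 in
-- two blow-up existence calls, one 080B composite, one uniqueness transport
/-- **(LF_adm-CM) ∧ (LF_adm-F) ⇒ (LF_adm).** See the module docstring for the proof; the one new point is that the intermediate model is again
ADMISSIBLE (its centre on `Spec 𝒪_{X,x}` is supported in `supp I ∪ {closed point} ⊆ Sing`, the closed point being singular since `x ∉ Reg X`).
[folklore assembly; cite: StacksProject, Tag 080B; Tag 085U] -/
theorem localFullificationFibreAdmGe4_of_split
    (hCM : LocalMacaulayficationFibreAdmGe4) (hF : LocalFInjectivizationFibreAdmGe4) :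
    LocalFullificationFibreAdmGe4.LocalFullificationFibreAdmGe4 := by
  intro d hd p hp k _ _ X f hsep hft hqc hint x hxcl hxs hx S' g I hI hIadm hg hreg
  classical
  haveI : IsLocallyNoetherian X := LocallyOfFiniteType.isLocallyNoetherian f
  haveI : IsIntegral S' := hg.isIntegral hI
  haveI : IsProper g := hg.isProper
  haveI : IsLocallyNoetherian S' := LocallyOfFiniteType.isLocallyNoetherian g
  haveI : CompactSpace S' := QuasiCompact.compactSpace_of_compactSpace g
  haveI : IsNoetherian S' := {}
  -- Step 1: Macaulayfy `S'` along a fibre-supported `𝓚₁`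
  obtain ⟨𝓚₁, h𝓚₁ne, h𝓚₁fib, h𝓚₁cm⟩ := hCM d hd p hp k X f hsep hft hqc hint x hxcl hxs hx S' g I hI hIadm hg hreg
  obtain ⟨S₁, π₁, hπ₁⟩ := exists_isBlowup S' 𝓚₁
  haveI : IsIntegral S₁ := hπ₁.isIntegral h𝓚₁ne
  haveI : IsProper π₁ := hπ₁.isProper
  haveI : IsLocallyNoetherian S₁ := LocallyOfFiniteType.isLocallyNoetherian π₁
  haveI : CompactSpace S₁ := QuasiCompact.compactSpace_of_compactSpace π₁
  haveI : IsNoetherian S₁ := {}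
  -- `S₁ → Spec 𝒪_{X,x}` is again a blowing up, along a non-zero centre (080B)
  obtain ⟨I₁, hI₁, hI₁T⟩ := hg.exists_isBlowup_comp_supported g I π₁ 𝓚₁
    ((I.support : Set (Spec (X.presheaf.stalk x))) ∪ {closedPoint (X.presheaf.stalk x)}) Set.subset_union_left hπ₁
    (fun s hs => Or.inr (h𝓚₁fib s hs))
  have hI₁ne : I₁ ≠ ⊥ := RegularBlowupModelDim2.ne_bot_of_isBlowup hI₁
  -- the new centre is again ADMISSIBLE: `supp I ∪ {closed point} ⊆ Sing (Spec 𝒪_{X,x})`, the closed point being singular since `x ∉ Reg X`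
  have hI₁adm : (I₁.support : Set (Spec (X.presheaf.stalk x))) ⊆ (Scheme.regularLocus (Spec (X.presheaf.stalk x)))ᶜ := by
    refine hI₁T.trans (Set.union_subset hIadm ?_)
    rintro _ rfl hreg0
    apply hxs
    haveI : Flat (X.fromSpecStalk x) := flat_fromSpecStalk X x
    have := (mem_regularLocus_iff_of_flat_of_isPreimmersion (X.fromSpecStalk x) (closedPoint (X.presheaf.stalk x))).mp hreg0
    rwa [Scheme.fromSpecStalk_closedPoint] at this
  -- the composite structure map, pointwise
  have hcomp : ∀ s : S₁, (π₁ ≫ g).base s = g.base (π₁.base s) := fun s => by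
    rw [Scheme.Hom.comp_apply]
  -- `S₁` is regular off its closed fibre: `π₁` is a local isomorphism off `supp 𝓚₁ ⊆` (closed fibre of `S'`)
  have hreg₁ : ∀ s : S₁, (π₁ ≫ g).base s ≠ closedPoint (X.presheaf.stalk x) → s ∈ Scheme.regularLocus S₁ := by
    intro s hs
    rw [hcomp] at hs
    have hs' : π₁.base s ∉ (𝓚₁.support : Set S') := fun h => hs (h𝓚₁fib _ h)
    haveI := hπ₁.isIso_compl
    exact (mem_regularLocus_iff_of_isIso_morphismRestrict π₁ ⟨(𝓚₁.support : Set S')ᶜ, 𝓚₁.support.isClosed.isOpen_compl⟩ s hs').mpr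
      (hreg _ hs)
  -- `S₁` is Cohen–Macaulay everywhere
  have hcm₁ : ∀ s : S₁, CMCl (S₁.presheaf.stalk s) := fun s => (h𝓚₁cm S₁ π₁ hπ₁ s).2
  -- Step 2: F-injectivise `S₁` along a fibre-supported `𝓚₂`
  obtain ⟨𝓚₂, h𝓚₂ne, h𝓚₂fib, h𝓚₂full⟩ := hF d hd p hp k X f hsep hft hqc hint x hxcl hxs hx S₁ (π₁ ≫ g) I₁ hI₁ne hI₁adm hI₁ hreg₁ hcm₁
  obtain ⟨S₂, π₂, hπ₂⟩ := exists_isBlowup S₁ 𝓚₂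
  haveI : IsIntegral S₂ := hπ₂.isIntegral h𝓚₂ne
  -- Step 3: the composite `S₂ → S₁ → S'` is a blowing up of `S'` along a FIBRE-SUPPORTED `𝓚 ≠ ⊥` (080B with `T :=` the closed fibre)
  obtain ⟨𝓚, h𝓚, h𝓚T⟩ := hπ₁.exists_isBlowup_comp_supported π₁ 𝓚₁ π₂ 𝓚₂
    {s : S' | g.base s = closedPoint (X.presheaf.stalk x)} (fun s hs => h𝓚₁fib s hs) hπ₂
    (fun s hs => by
      have h := h𝓚₂fib s hs
      rw [hcomp] at h
      exact h)
  have h𝓚ne : 𝓚 ≠ ⊥ := RegularBlowupModelDim2.ne_bot_of_isBlowup h𝓚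
  refine ⟨𝓚, h𝓚ne, fun s hs => h𝓚T hs, fun S'' π hπ s => ?_⟩
  -- Step 4: every blowing up along `𝓚` is `S₂` up to an isomorphism over `S'`; FULL transports along stalk isomorphisms
  obtain ⟨e, -, -⟩ := hπ.unique h𝓚
  exact FTemkinClosedPoints.fullCl_of_isIso_stalkMap' p e.hom s (h𝓚₂full S₂ π₂ hπ₂ (e.hom s))

/-- **(LF_adm) ⟺ (LF_adm-CM) ∧ (LF_adm-F)**. [folklore assembly] -/
theorem localFullificationFibreAdmGe4_iff_split :
    LocalFullificationFibreAdmGe4.LocalFullificationFibreAdmGe4 ↔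
      LocalMacaulayficationFibreAdmGe4 ∧ LocalFInjectivizationFibreAdmGe4 :=
  ⟨fun h => ⟨localMacaulayficationFibreAdmGe4_of_localFullificationFibreAdmGe4 h,
    localFInjectivizationFibreAdmGe4_of_localFullificationFibreAdmGe4 h⟩,
    fun h => localFullificationFibreAdmGe4_of_split h.1 h.2⟩


/-! ## §4 The CM-half from Česnavičius's blow-up Macaulayfication (as a binder), and door v37's shape in the admissible category -/

/-- **(LF_adm-CM) ⟸ [Česnavičius 2021, Thm. 5.3]** (the fact as the binder `hM`, text = `CesnaviciusBlowupMacaulayfication` of the FACT-REQUEST), via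
`LocalMacaulayficationOfFact.exists_cmCentre_of_fact` (the extra hypotheses are simply discarded). [OURS · conditional on the fact as typed]
[cite: Cesnavicius2021, Thm. 5.3] -/
theorem localMacaulayficationFibreAdmGe4_of_fact
    (hM : ∀ (Y : Scheme.{0}) [IsIntegral Y] [IsNoetherian Y], Scheme.IsExcellent Y →
      ∃ Z : Y.IdealSheafData,
        (∀ y : Y, y ∈ (Z.support : Set Y) →
          ¬ (∀ d : ℕ, ringKrullDim (Y.presheaf.stalk y) = d →
              ∀ s : Fin d → Y.presheaf.stalk y, (Ideal.span (Set.range s)).radical.IsMaximal →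
                RingTheory.Sequence.IsWeaklyRegular (Y.presheaf.stalk y) (List.ofFn s))) ∧
        ∀ (Y' : Scheme.{0}) (π : Y' ⟶ Y), IsBlowup π Z →
          ∀ y' : Y', ∀ d : ℕ, ringKrullDim (Y'.presheaf.stalk y') = d →
            ∀ s : Fin d → Y'.presheaf.stalk y', (Ideal.span (Set.range s)).radical.IsMaximal →
              RingTheory.Sequence.IsWeaklyRegular (Y'.presheaf.stalk y') (List.ofFn s)) :
    LocalMacaulayficationFibreAdmGe4 := by
  intro d _ p hp k _ _ X f _ hft _ hint x _ _ _ S' g I hI _ hg hreg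
  haveI := hft
  exact LocalMacaulayficationOfFact.exists_cmCentre_of_fact hM p hp f x S' g I hI hg hreg

/-- **(LF_adm) ⟸ [Česnavičius 2021, Thm. 5.3] ∧ (LF_adm-F)** — door v37's shape in the admissible category.
[OURS · conditional on the fact as typed and on the CANDIDATE F-half] [cite: Cesnavicius2021, Thm. 5.3] -/
theorem localFullificationFibreAdmGe4_of_fact_of_F
    (hM : ∀ (Y : Scheme.{0}) [IsIntegral Y] [IsNoetherian Y], Scheme.IsExcellent Y →
      ∃ Z : Y.IdealSheafData,
        (∀ y : Y, y ∈ (Z.support : Set Y) →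
          ¬ (∀ d : ℕ, ringKrullDim (Y.presheaf.stalk y) = d →
              ∀ s : Fin d → Y.presheaf.stalk y, (Ideal.span (Set.range s)).radical.IsMaximal →
                RingTheory.Sequence.IsWeaklyRegular (Y.presheaf.stalk y) (List.ofFn s))) ∧
        ∀ (Y' : Scheme.{0}) (π : Y' ⟶ Y), IsBlowup π Z →
          ∀ y' : Y', ∀ d : ℕ, ringKrullDim (Y'.presheaf.stalk y') = d →
            ∀ s : Fin d → Y'.presheaf.stalk y', (Ideal.span (Set.range s)).radical.IsMaximal →
              RingTheory.Sequence.IsWeaklyRegular (Y'.presheaf.stalk y') (List.ofFn s))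
    (hF : LocalFInjectivizationFibreAdmGe4) :
    LocalFullificationFibreAdmGe4.LocalFullificationFibreAdmGe4 :=
  localFullificationFibreAdmGe4_of_split (localMacaulayficationFibreAdmGe4_of_fact hM) hF

end Summit.ResolutionOfSingularities.ResolutionOfSingularities.Theorems.FInjectiveMacaulayfication.LocalFullificationFibreAdmGe4Split

end
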